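import Literature.NumberTheory.PAdicHodge.TateAlmostEtaleEtaleStep
import Literature.NumberTheory.PAdicHodge.BaseGaloisAction
import Mathlib.FieldTheory.Galois.Infinite
import HarnessLib

/-!
# Principal units are `e`-divisible inside every subfield of `F̄` (`p ∤ e`), Hensel-free
# (toward the tame structure of prime-to-`p` extensions; Tate 1967 §3.2 / Serre, *Local Fields* IV §4)

Notation of the `TateAlmostEtale*` files (`K₀ = PadicBase F p hp ⊆ F̄ = NormedAlgClosure F`, `G₀ = Gal(F̄/K₀)` acting by
isometries). THEOREMS ONLY (no definition, no named fact, no `sorry`). The tame structure theorem — the remaining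
obligation (`stub_tameStructure`) of the unconditional Kummer route to Tate's (TS1), crux file
`Cruxes/StarredOptimalManinUnitFiveSeven/Lines/kato-lever-TS1-kummer-route.md` §4 — uses Hensel's lemma in the form
«a principal unit of a henselian field has an `e`-th root in the field for `p ∤ e`». This file proves that statement
for EVERY intermediate field `K₀ ⊆ T ⊆ F̄` WITHOUT residue fields or Hensel's lemma:

* `TateAlmostEtale.exists_root_norm_sub_one_lt` : if `‖u − 1‖ < 1` and `e ≠ 0` then some root `w ∈ F̄` of `X^e = u` has
  `‖w − 1‖ < 1` (`∏_{w^e = u} (1 − w) = 1 − u`);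
* `TateAlmostEtale.mem_of_pow_mem_of_norm_sub_one_lt` : if `p ∤ e`, `w^e ∈ T` and `‖w − 1‖ < 1` then `w ∈ T` — every
  `g ∈ Gal(F̄/T)` is an isometry fixing `w^e`, so `g w = ζ w` with `ζ^e = 1`, and `ζ ≠ 1` would give
  `‖g w − w‖ = ‖ζ − 1‖ = 1` (roots of unity of order prime to `p` are at distance `1`, tree
  `norm_sub_eq_one_of_pow_eq_one`) against `‖g w − w‖ ≤ ‖w − 1‖ < 1`; conclude by the Galois correspondence
  (Mathlib `InfiniteGalois.fixedField_fixingSubgroup`);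
* `TateAlmostEtale.exists_pow_eq_of_norm_sub_one_lt` (**main**) : **`u ∈ T`, `‖u − 1‖ < 1`, `p ∤ e`, `e ≠ 0` ⇒
  `u = w^e` with `w ∈ T`, `‖w − 1‖ < 1`.**

[cite: SerreLocalFields1979, Ch. IV §4 and Ch. II §3 (Hensel)] [cite: Tate1967, §3.2]. BSD is not proved here.
-/

noncomputable section

open Polynomial IntermediateField Module ValuativeRel Field

namespace Literature.NumberTheory.PAdicHodge

namespace TateAlmostEtale

open Literature.NumberTheory.GaloisRepresentations
open Literature.NumberTheory.GaloisRepresentations.IsNonarchimedeanLocalField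

variable {F : Type} [Field F] [ValuativeRel F] [TopologicalSpace F] [IsNonarchimedeanLocalField F]
  [CharZero F] {p : ℕ} [Fact p.Prime] (hp : valuation F p < 1)

omit [CharZero F] [Fact p.Prime] in
/-- A product of elements of norm `1` has norm `1`. [folklore] -/
private theorem norm_multiset_prod_eq_one (m : Multiset (NormedAlgClosure F)) (hm : ∀ t ∈ m, ‖t‖ = 1) :
    ‖m.prod‖ = 1 := by
  induction m using Multiset.induction_on with
  | empty => simp
  | cons a m ih =>
    rw [Multiset.prod_cons, norm_mul, hm a (Multiset.mem_cons_self a m), one_mul]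
    exact ih fun t ht => hm t (Multiset.mem_cons_of_mem ht)

omit [CharZero F] [Fact p.Prime] in
/-- A principal unit has norm `1`. [folklore] -/
private theorem norm_eq_one_of_norm_sub_one_lt {u : NormedAlgClosure F} (hu : ‖u - 1‖ < 1) : ‖u‖ = 1 := by
  have h : u = (u - 1) + 1 := by ring
  rw [h, IsUltrametricDist.norm_add_eq_max_of_norm_ne_norm (by rw [norm_one]; exact hu.ne), norm_one]
  exact max_eq_right hu.le

omit [CharZero F] [Fact p.Prime] in
/-- **Some `e`-th root of a principal unit is a principal unit**: if `‖u − 1‖ < 1` and `e ≠ 0` then there is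
`w ∈ F̄` with `w^e = u` and `‖w − 1‖ < 1` (the roots have norm `1`, and `∏ (1 − w) = 1 − u` has norm `< 1`).
[cite: SerreLocalFields1979, Ch. IV §4] -/
theorem exists_root_norm_sub_one_lt {e : ℕ} (he0 : e ≠ 0) {u : NormedAlgClosure F} (hu : ‖u - 1‖ < 1) :
    ∃ w : NormedAlgClosure F, w ^ e = u ∧ ‖w - 1‖ < 1 := by
  classical
  obtain ⟨P, hP⟩ : ∃ P : (NormedAlgClosure F)[X], P = X ^ e - C u := ⟨_, rfl⟩
  have hmo : P.Monic := by rw [hP]; exact monic_X_pow_sub_C u he0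
  have hsp : P.Splits := IsAlgClosed.splits P
  have hev : P.eval 1 = 1 - u := by rw [hP, eval_sub, eval_pow, eval_X, eval_C, one_pow]
  have hprod : (P.roots.map (fun w => 1 - w)).prod = 1 - u := by
    rw [← hev, hsp.eval_eq_prod_roots_of_monic hmo]
  -- every root has norm `1`
  have hroot : ∀ w ∈ P.roots, w ^ e = u := by
    intro w hw
    rw [mem_roots hmo.ne_zero, IsRoot, hP, eval_sub, eval_pow, eval_X, eval_C, sub_eq_zero] at hw
    exact hw
  have hu1 : ‖u‖ = 1 := norm_eq_one_of_norm_sub_one_lt hu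
  have hnorm : ∀ w ∈ P.roots, ‖w‖ = 1 := by
    intro w hw
    have h : ‖w‖ ^ e = 1 := by rw [← norm_pow, hroot w hw, hu1]
    exact (pow_eq_one_iff_of_nonneg (norm_nonneg _) he0).mp h
  -- not all factors `1 − w` can have norm `1`
  by_contra hne
  push Not at hne
  have hall : ∀ t ∈ P.roots.map (fun w => 1 - w), ‖t‖ = 1 := by
    intro t ht
    obtain ⟨w, hw, rfl⟩ := Multiset.mem_map.mp ht
    have hle : ‖1 - w‖ ≤ 1 := by
      rw [sub_eq_add_neg]
      refine (IsUltrametricDist.norm_add_le_max _ _).trans (max_le (by rw [norm_one]) ?_)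
      rw [norm_neg, hnorm w hw]
    have hge : 1 ≤ ‖1 - w‖ := by rw [norm_sub_rev]; exact hne w (hroot w hw)
    exact le_antisymm hle hge
  have h1 : ‖1 - u‖ = 1 := by rw [← hprod]; exact norm_multiset_prod_eq_one _ hall
  rw [norm_sub_rev, h1] at hu
  exact lt_irrefl _ hu

/-- **An `e`-th root (`p ∤ e`) of an element of `T` which is a principal unit lies in `T`** — for every
intermediate field `K₀ ⊆ T ⊆ F̄`: each `g ∈ Gal(F̄/T)` is an isometry with `g w = ζ w`, `ζ^e = 1`, and `ζ ≠ 1` would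
force `‖g w − w‖ = 1 > ‖w − 1‖ ≥ ‖g w − w‖`; so `w` is fixed by `Gal(F̄/T)`, i.e. `w ∈ T` (Galois correspondence).
[cite: SerreLocalFields1979, Ch. II §3 (Hensel) and Ch. IV §4] -/
theorem mem_of_pow_mem_of_norm_sub_one_lt (T : IntermediateField (PadicBase F p hp) (NormedAlgClosure F))
    {e : ℕ} (he : ¬ p ∣ e) (he0 : e ≠ 0) {w : NormedAlgClosure F} (hwT : w ^ e ∈ T) (hw : ‖w - 1‖ < 1) :
    w ∈ T := by
  haveI : IsGalois (PadicBase F p hp) (NormedAlgClosure F) := inferInstance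
  have hw1 : ‖w‖ = 1 := norm_eq_one_of_norm_sub_one_lt hw
  have hw0 : w ≠ 0 := fun h => by rw [h, norm_zero] at hw1; exact zero_ne_one hw1
  -- `w` is fixed by `Gal(F̄/T)`
  have hfix : ∀ g ∈ T.fixingSubgroup, g • w = w := by
    intro g hg
    by_contra hne
    have hgu : (g • w) ^ e = w ^ e := by
      rw [← smul_pow']
      exact (IntermediateField.mem_fixingSubgroup_iff _ _).mp hg _ hwT
    -- `ζ := g w / w` is an `e`-th root of unity `≠ 1`
    set ζ : NormedAlgClosure F := g • w / w with hζ
    have hζe : ζ ^ e = 1 := by rw [hζ, div_pow, hgu, div_self (pow_ne_zero _ hw0)]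
    have hζ1 : ζ ≠ 1 := by
      intro h
      rw [hζ, div_eq_one_iff_eq hw0] at h
      exact hne h
    have hgw : g • w = ζ * w := by rw [hζ, div_mul_cancel₀ _ hw0]
    -- `‖g w − w‖ = 1`
    have h1 : ‖g • w - w‖ = 1 := by
      rw [hgw, ← sub_one_mul, norm_mul, norm_sub_eq_one_of_pow_eq_one hp he he0 hζe (one_pow e) hζ1, hw1, mul_one]
    -- `‖g w − w‖ < 1`
    have h2 : ‖g • w - w‖ < 1 := by
      have h3 : g • w - w = g • (w - 1) - (w - 1) := by rw [smul_sub, smul_one]; ring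
      rw [h3, sub_eq_add_neg]
      refine (IsUltrametricDist.norm_add_le_max _ _).trans_lt (max_lt ?_ ?_)
      · rw [BaseGaloisGroup.norm_smul]; exact hw
      · rw [norm_neg]; exact hw
    rw [h1] at h2
    exact lt_irrefl _ h2
  have hmem : w ∈ IntermediateField.fixedField T.fixingSubgroup :=
    (IntermediateField.mem_fixedField_iff _ _).2 fun g hg => hfix g hg
  rwa [InfiniteGalois.fixedField_fixingSubgroup] at hmem

/-- **Principal units are `e`-divisible inside `T` for `p ∤ e`** (Hensel-free): for every intermediate field
`K₀ ⊆ T ⊆ F̄`, `u ∈ T` with `‖u − 1‖ < 1`, and `e ≠ 0` with `p ∤ e`, there is `w ∈ T` with `w^e = u` and `‖w − 1‖ < 1`.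
This is the Hensel input of the tame structure theorem for prime-to-`p` extensions (totally tamely ramified extensions
are radical). [cite: SerreLocalFields1979, Ch. II §3 (Hensel) and Ch. IV §4] [cite: Tate1967, §3.2] -/
theorem exists_pow_eq_of_norm_sub_one_lt (T : IntermediateField (PadicBase F p hp) (NormedAlgClosure F))
    {e : ℕ} (he : ¬ p ∣ e) (he0 : e ≠ 0) {u : NormedAlgClosure F} (huT : u ∈ T) (hu : ‖u - 1‖ < 1) :
    ∃ w ∈ T, w ^ e = u ∧ ‖w - 1‖ < 1 := by
  obtain ⟨w, hwe, hw⟩ := exists_root_norm_sub_one_lt (F := F) he0 hu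
  exact ⟨w, mem_of_pow_mem_of_norm_sub_one_lt hp T he he0 (hwe ▸ huT) hw, hwe, hw⟩

/-- **Teichmüller representatives, Hensel-free**: if `u ∈ T` satisfies `‖u^N − 1‖ < 1` for some `N ≠ 0` with
`p ∤ N`, then there is a root of unity `ω ∈ T`, `ω^N = 1`, with `‖u − ω‖ < 1` (namely `ω = u / w` for the `N`-th root
`w ∈ T` of the principal unit `u^N`, `‖w − 1‖ < 1`). [cite: SerreLocalFields1979, Ch. II §4 Prop. 8 (multiplicative representatives)] -/
theorem exists_rootOfUnity_norm_sub_lt (T : IntermediateField (PadicBase F p hp) (NormedAlgClosure F))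
    {N : ℕ} (hN : ¬ p ∣ N) (hN0 : N ≠ 0) {u : NormedAlgClosure F} (huT : u ∈ T) (hu : ‖u ^ N - 1‖ < 1) :
    ∃ ω ∈ T, ω ^ N = 1 ∧ ‖u - ω‖ < 1 := by
  obtain ⟨w, hwT, hwN, hw⟩ := exists_pow_eq_of_norm_sub_one_lt hp T hN hN0 (pow_mem huT N) hu
  have hw1 : ‖w‖ = 1 := norm_eq_one_of_norm_sub_one_lt hw
  have hw0 : w ≠ 0 := fun h => by rw [h, norm_zero] at hw1; exact zero_ne_one hw1
  have huN1 : ‖u ^ N‖ = 1 := norm_eq_one_of_norm_sub_one_lt hu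
  have hu1 : ‖u‖ = 1 := by
    rw [norm_pow] at huN1
    exact (pow_eq_one_iff_of_nonneg (norm_nonneg _) hN0).mp huN1
  refine ⟨u / w, div_mem huT hwT, ?_, ?_⟩
  · rw [div_pow, ← hwN, div_self (pow_ne_zero _ hw0)]
  · have h1 : u - u / w = (u / w) * (w - 1) := by field_simp
    rw [h1, norm_mul, norm_div, hu1, hw1, div_one, one_mul]
    exact hw

end TateAlmostEtale

end Literature.NumberTheory.PAdicHodge

end
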